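import Summits.ResolutionOfSingularities.ResolutionOfSingularities.Theorems.UniversalCellsCampaignW82ExponentZeroProofs
import HarnessLib

/-!
# [OURS · L1 W8.2] Exponent zero is not enough — LINKS: the crux disprover's near-miss
# `not_smoothTwist_levelZero` (Cruxes/PrimeFieldToPerfect/Disproof.lean §3), proved verbatim

Cell `res-hironaka`, LADDER-RESOLUTION rung L, slot W8.2, host route `UniversalCells`, host item
`PrimeFieldToPerfect` (stmt-ResolutionOfSingularities-15233). Leaf file, Theses-free (the finite generation
of `𝔽_p(t)` is re-proved here rather than imported from the crux's Negative module, which lies in the cone of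
Theses.UniversalCells). Written by res-L1-s82-pv-1 (gen 3).

WHAT IS PROVED. `not_smoothTwist_levelZero p` — for every prime `p`, with EXACTLY the signature of the sorried
near-miss of the same name in Cruxes/PrimeFieldToPerfect/Disproof.lean §3 ("NEAR-MISS (s1): level 0 does not
suffice — no smooth proper birational model at `K' = K`"): it is false that every separated `X₀` of finite type
over a finitely generated field `K` of characteristic `p` which is integral over the perfect closure admits a
proper birational `π : Y ⟶ X₀` with `Y ⟶ Spec K` smooth. Witness `K = 𝔽_p(t)` (finitely generated: `subfield_closure_X_baseField`, the same computation as
`Theorems.PrimeFieldToPerfect.Negative.subfield_closure_ratFuncX`), `X₀` = Kollár's curve `y^{p+1} = x^p − t`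
(`CampaignW82.KollarCurve.not_hasSmoothProperBirationalModel`, `.integralOverPerfectClosure`). The disprover may
now replace its `sorry` by this theorem; and `not_smoothTwist_levelZero_all` is the `∀ p` shape.

HONEST FRAMING. OURS; not a statement of H. Hironaka's manuscript [Hironaka2017]; nothing attributed to its
author. The crux `PrimeFieldToPerfect` itself is NOT refuted (it is implied by the summit); what is refuted is
the strengthening "no Frobenius twist needed" of its kernel. AI work, weaker than expert review.

## References (locators)
* J. Kollár, *Lectures on Resolution of Singularities* (2007), 1.19. [Kollar2007]
* Cruxes/PrimeFieldToPerfect/Disproof.lean §3 (`not_smoothTwist_levelZero`, near-miss, 2026-08-17); KERNEL.md §4 (s1).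
-/

noncomputable section

set_option linter.dupNamespace false -- mandated namespace of this single-conjunct summit

open _root_.CategoryTheory _root_.CategoryTheory.Limits _root_.AlgebraicGeometry
open Literature.AlgebraicGeometry.Resolution Literature.Barriers.ResolutionOfSingularities

namespace Summit.ResolutionOfSingularities.ResolutionOfSingularities.Theorems.CampaignW82

/-- `𝔽_p(t)` is finitely generated as a field (by `t`): the hypothesis `∃ s, Subfield.closure s = ⊤` of the
kernel signature holds for the witness field. (Same statement and proof as
`Theorems.PrimeFieldToPerfect.Negative.subfield_closure_ratFuncX`, re-proved to stay out of the Theses cone.)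
[folklore] -/
theorem subfield_closure_X_baseField (p : ℕ) [Fact p.Prime] :
    ∃ s : Finset (baseField p), Subfield.closure (s : Set (baseField p)) = ⊤ := by
  -- adapted from Theorems/PrimeFieldToPerfect/Negative/SmoothTwistFalseWithoutGeomIntegral.lean
  classical
  refine ⟨{RatFunc.X}, ?_⟩
  rw [Finset.coe_singleton, eq_top_iff]
  rintro f -
  set S : Subfield (baseField p) := Subfield.closure {RatFunc.X} with hS
  have hX : (RatFunc.X : baseField p) ∈ S := Subfield.subset_closure rfl
  have hpoly : ∀ q : Polynomial (ZMod p), algebraMap (Polynomial (ZMod p)) (baseField p) q ∈ S := by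
    intro q
    induction q using Polynomial.induction_on with
    | C a =>
        rw [RatFunc.algebraMap_C]
        have : (RatFunc.C a : baseField p) = ((a.val : ℕ) : baseField p) :=
          calc (RatFunc.C a : baseField p) = RatFunc.C ((a.val : ℕ) : ZMod p) := by
                rw [ZMod.natCast_zmod_val]
            _ = ((a.val : ℕ) : baseField p) := map_natCast _ _
        rw [this]
        exact natCast_mem S a.val
    | add q r hq hr => rw [map_add]; exact add_mem hq hr
    | monomial n a h =>
        rw [pow_succ, ← mul_assoc, map_mul, RatFunc.algebraMap_X]
        exact mul_mem h hX
  rw [← RatFunc.num_div_denom f]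
  exact div_mem (hpoly _) (hpoly _)

/-- **Level `0` does not suffice (Disproof.lean §3 near-miss (s1), now a theorem).** The kernel `SmoothTwist p`
of crux `PrimeFieldToPerfect` with the purely inseparable level frozen at `K' = K` is FALSE for every prime `p`:
over the finitely generated field `K = 𝔽_p(t)`, Kollár's curve `y^{p+1} = x^p − t` is separated of finite type
and integral over the perfect closure, yet has no proper birational model smooth over `K`
(`KollarCurve.not_hasSmoothProperBirationalModel`: such a model would be isomorphic to the regular curve, which
is not smooth). Signature verbatim from Cruxes/PrimeFieldToPerfect/Disproof.lean. [cite: Kollar2007, 1.19 (Curves over nonperfect fields)] -/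
theorem not_smoothTwist_levelZero (p : ℕ) [Fact p.Prime] :
    ¬ ∀ (K : Type) [Field K] [CharP K p], (∃ s : Finset K, Subfield.closure (s : Set K) = ⊤) →
      ∀ (X₀ : Scheme.{0}) (f₀ : X₀ ⟶ Spec (.of K)),
        IsSeparated f₀ → LocallyOfFiniteType f₀ → QuasiCompact f₀ →
        (∃ (L : Type) (_ : Field L) (_ : PerfectField L) (_ : Algebra K L)
            (_ : IsPurelyInseparable K L),
            IsIntegral (pullback f₀ (Spec.map (CommRingCat.ofHom (algebraMap K L))))) →
        ∃ (Y : Scheme.{0}) (π : Y ⟶ X₀), IsProper π ∧ IsBirational π ∧ Smooth (π ≫ f₀) := by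
  intro h
  have hpq : ¬ p ∣ p + 1 := not_dvd_succ_self p
  haveI : Fact (1 < p + 1) := ⟨by have := (Fact.out : p.Prime).one_lt; omega⟩
  exact KollarCurve.not_hasSmoothProperBirationalModel p (p + 1) hpq
    (h (baseField p) (subfield_closure_X_baseField p) _ _
      inferInstance (KollarCurve.locallyOfFiniteType_f₀ p (p + 1)) inferInstance
      (KollarCurve.integralOverPerfectClosure p (p + 1) hpq))

/-- The same for all primes at once (`∀ p prime` shape of the skeleton's `Sig.stub_smoothTwist` with the level
frozen at `K' = K` and the resolution hypotheses dropped as irrelevant): false already at `p = 2`.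
[cite: Kollar2007, 1.19 (Curves over nonperfect fields)] -/
theorem not_smoothTwist_levelZero_all :
    ¬ ∀ p : ℕ, p.Prime → ∀ (K : Type) [Field K] [CharP K p],
      (∃ s : Finset K, Subfield.closure (s : Set K) = ⊤) →
      ∀ (X₀ : Scheme.{0}) (f₀ : X₀ ⟶ Spec (.of K)),
        IsSeparated f₀ → LocallyOfFiniteType f₀ → QuasiCompact f₀ →
        (∃ (L : Type) (_ : Field L) (_ : PerfectField L) (_ : Algebra K L)
            (_ : IsPurelyInseparable K L),
            IsIntegral (pullback f₀ (Spec.map (CommRingCat.ofHom (algebraMap K L))))) →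
        ∃ (Y : Scheme.{0}) (π : Y ⟶ X₀), IsProper π ∧ IsBirational π ∧ Smooth (π ≫ f₀) := by
  intro h
  haveI : Fact (Nat.Prime 2) := ⟨Nat.prime_two⟩
  exact not_smoothTwist_levelZero 2 (fun K _ _ hK X₀ f₀ hs hl hq hi => h 2 Nat.prime_two K hK X₀ f₀ hs hl hq hi)

end Summit.ResolutionOfSingularities.ResolutionOfSingularities.Theorems.CampaignW82

end
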